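import Literature.Computability.FineGrained.IPRenameYTable
import HarnessLib

/-!
# The renaming machine of Impagliazzo–Paturi's Lemma 2, XVIII: one disjunct (threshold test, header, clauses)

Family `fine-grained` (trunk T-CPLX-FINE). Eighteenth file of the machine half of
Impagliazzo–Paturi, *On the complexity of k-SAT*, JCSS 62 (2001), Lemma 2 (the named fact
`ipRename_reduceList_computable` of `IPLemma2Assembly.lean`): for the current mask (tables in
`ac`, `bt`, `szs`, `na`) and the current `f`-vector (unary digits `dW ds` in `fv`, last block
first, `IPRenameOdometer.lean`), decide the threshold test `t ≤ Σ f_i` and, if it holds, push the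
encoding of the disjunct `IPRename.reduce P φ` — header `numVars - Σ f_i` in binary, comma, the
clauses `outClauses P F` (`runs_emitOut`, `IPRenameDrivers.lean`), closing blank — reversed onto
the accumulator `acc` of the emission bank.

* bricks: `toBinG` (unary to binary by repeated `incrG`), `hdrEmit` (the header: copy `n`
  (unary, register `nun`), subtract the digit sum of `fv` by `pairOff`, convert, pour);
* `vecEmit m` (header, `ytBuild`, `emitOut`, blank, clear the `Y`-table) and `vecStep m` (the
  threshold test by `tallyB`/`cmpU` against the unary threshold in `thr`, then `vecEmit`);
* the base hypotheses `VBase` of this level (data registers of the mask, `f`-vector, `n`, `t`;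
  every scratch register of every sub-phase empty) with its frame lemmas, the store family
  `vS acc T = Sum.elim (tbSt [] acc …) T`;
* **`runs_vecStep`**: `acc` receives `(vecW P F n ds)ʳ` if `t ≤ Σ ds`, nothing otherwise, and
  every other register is restored; **`vecW_eq`**: for `P.fv = ds.reverse` dominated by the
  nonempty block sizes, `vecW P φ.clauses φ.numVars ds = (reduce P φ).encode ++ [blank]`.

## References

* R. Impagliazzo, R. Paturi, *On the complexity of k-SAT*, J. Comput. System Sci. 62 (2001)
  367–375, doi:10.1006/jcss.2000.1727, Lemma 2 (p. 373) and its "Moreover" sentence (the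
  reduction is computable within the stated time); conference version: *Complexity of k-SAT*,
  Proc. 14th IEEE CCC (1999), doi:10.1109/ccc.1999.766282, Theorem 2 (p. 4). (JCSS version not
  held; acquisition request acq-00143; CCC version held.)
* T. Nipkow, G. Klein, *Concrete Semantics with Isabelle/HOL*, Springer 2014, Ch. 7 (big-step
  reasoning about loops, as in `SymbolPrograms.lean`).
-/

namespace Literature.Computability.FineGrained.IPRenameM

open _root_.Computability Complexity Complexity.ACom Sparsifier IPRename
open Compaction (uflag uflag_true uflag_false)

/-! ### Unary to binary by repeated increments -/

/-- `toBinG u c f j`: one binary increment of the numeral register `c` (`incrG`,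
`IPRenameOccBricks.lean`) per tick of the unary register `u` (consumed). [folklore] -/
def toBinG (u c f j : Reg) : RProg := loop u fun _ => incrG c f j

/-- **`toBinG`**: `c = bitsN m₀` becomes `bitsN (m₀ + U)`, `U` the number of ticks in `u`.
[folklore] -/
theorem runs_toBinG {u c f j : Reg} (huc : u ≠ c) (huf : u ≠ f) (huj : u ≠ j) (hcf : c ≠ f) (hcj : c ≠ j) (hfj : f ≠ j) :
    ∀ (U m₀ : ℕ) (R : RStore), R u = ticks Γ'.blank U → R c = bitsN m₀ → R f = [] → R j = [] →
      Runs (toBinG u c f j) R (Function.update (Function.update R u []) c (bitsN (m₀ + U))) ((9 * (m₀ + U) + 11) * U + 1)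
  | 0, m₀, R, hu, hc, _, _ => by
    refine (Runs.loop_nil _ hu).of_eq ?_ (by simp)
    rw [Nat.add_zero, ← hc, Function.update_eq_self_iff.2 (by simp [huc.symm]), Function.update_eq_self_iff.2 hu.symm]
  | U + 1, m₀, R, hu, hc, hf, hj => by
    rw [ticks_succ] at hu
    have h1 := runs_incrG hcf hcj hfj m₀ (Function.update R u (ticks Γ'.blank U)) (by simp [huc.symm, hc]) (by simp [huf.symm, hf]) (by simp [huj.symm, hj])
    have ih := runs_toBinG huc huf huj hcf hcj hfj U (m₀ + 1) (Function.update (Function.update R u (ticks Γ'.blank U)) c (bitsN (m₀ + 1)))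
      (by simp [huc]) (by simp) (by simp [hcf.symm, huf.symm, hf]) (by simp [hcj.symm, huj.symm, hj])
    unfold toBinG at ih ⊢
    refine (Runs.loop_cons (f := fun _ => incrG c f j) hu h1 ih).of_eq ?_ ?_
    · rw [show m₀ + 1 + U = m₀ + (U + 1) by omega]
      funext q
      by_cases q1 : q = c; · subst q1; simp
      by_cases q2 : q = u; · subst q2; simp [huc]
      simp [q1, q2]
    · have hl : (encodeNat m₀).length ≤ m₀ := TokConv.length_encodeNat_le m₀
      have e : (9 * (m₀ + 1 + U) + 11) * U = (9 * (m₀ + (U + 1)) + 11) * U := by ring_nf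
      nlinarith

/-! ### The store family of this level -/

/-- The store of this level: the emission bank with only the accumulator set, over the work
registers `T`. [folklore] -/
def vS (acc : List Γ') (T : AStore Γ' KR) : RStore := Sum.elim (tbSt [] acc [] [] [] [] []) T

/-- Reading a work register. [folklore] -/
@[simp] theorem vS_kr (acc : List Γ') (T : AStore Γ' KR) (x : KR) : vS acc T (kr x) = T x := rfl

/-- Reading the accumulator. [folklore] -/
@[simp] theorem vS_acc (acc : List Γ') (T : AStore Γ' KR) : vS acc T (tb TB.acc) = acc := rfl

/-- Reading the other emission registers. [folklore] -/
@[simp] theorem vS_vt (acc : List Γ') (T : AStore Γ' KR) : vS acc T (tb TB.vt) = [] := rfl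

/-- Updating a work register. [folklore] -/
@[simp] theorem update_vS_kr (acc : List Γ') (T : AStore Γ' KR) (x : KR) (u : List Γ') :
    Function.update (vS acc T) (kr x) u = vS acc (Function.update T x u) := by
  unfold vS; exact Sum.update_elim_inr

/-- Updating the accumulator. [folklore] -/
@[simp] theorem update_vS_acc (acc : List Γ') (T : AStore Γ' KR) (u : List Γ') :
    Function.update (vS acc T) (tb TB.acc) u = vS u T := by
  unfold vS; rw [Sum.update_elim_inl, update_tbSt_acc]

/-- `vS` unfolded. [folklore] -/
theorem vS_eq (acc : List Γ') (T : AStore Γ' KR) : vS acc T = Sum.elim (tbSt [] acc [] [] [] [] []) T := rfl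

/-! ### The temporaries of this level -/

/-- The store family `wS` over a base store: the temporaries of this level. [folklore] -/
def wS (S : RStore) (u1 fv2 u2 hd2 fl2 fl3 yt : List Γ') : RStore := fun r =>
  if r = kr KR.u1 then u1 else if r = kr KR.fv2 then fv2 else if r = kr KR.u2 then u2 else if r = kr KR.hd2 then hd2 else if r = kr KR.fl2 then fl2 else if r = kr KR.fl3 then fl3 else if r = kr KR.yt then yt else S r

section WsLemmas

variable (S : RStore) (u1 fv2 u2 hd2 fl2 fl3 yt w : List Γ')

/-- Reading `u1`. [folklore] -/
@[simp] theorem wS_u1 : wS S u1 fv2 u2 hd2 fl2 fl3 yt (kr KR.u1) = u1 := by simp [wS]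
/-- Reading `fv2`. [folklore] -/
@[simp] theorem wS_fv2 : wS S u1 fv2 u2 hd2 fl2 fl3 yt (kr KR.fv2) = fv2 := by simp [wS]
/-- Reading `u2`. [folklore] -/
@[simp] theorem wS_u2 : wS S u1 fv2 u2 hd2 fl2 fl3 yt (kr KR.u2) = u2 := by simp [wS]
/-- Reading `hd2`. [folklore] -/
@[simp] theorem wS_hd2 : wS S u1 fv2 u2 hd2 fl2 fl3 yt (kr KR.hd2) = hd2 := by simp [wS]
/-- Reading `fl2`. [folklore] -/
@[simp] theorem wS_fl2 : wS S u1 fv2 u2 hd2 fl2 fl3 yt (kr KR.fl2) = fl2 := by simp [wS]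
/-- Reading `fl3`. [folklore] -/
@[simp] theorem wS_fl3 : wS S u1 fv2 u2 hd2 fl2 fl3 yt (kr KR.fl3) = fl3 := by simp [wS]
/-- Reading `yt`. [folklore] -/
@[simp] theorem wS_yt : wS S u1 fv2 u2 hd2 fl2 fl3 yt (kr KR.yt) = yt := by simp [wS]
/-- Reading any other register. [folklore] -/
theorem wS_other {r : Reg} (h0 : r ≠ kr KR.u1) (h1 : r ≠ kr KR.fv2) (h2 : r ≠ kr KR.u2) (h3 : r ≠ kr KR.hd2) (h4 : r ≠ kr KR.fl2) (h5 : r ≠ kr KR.fl3) (h6 : r ≠ kr KR.yt) :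
    wS S u1 fv2 u2 hd2 fl2 fl3 yt r = S r := by simp [wS, h0, h1, h2, h3, h4, h5, h6]
/-- Reading `fv`. [folklore] -/
@[simp] theorem wS_fv : wS S u1 fv2 u2 hd2 fl2 fl3 yt (kr KR.fv) = S (kr KR.fv) := by simp [wS]
/-- Reading `szs`. [folklore] -/
@[simp] theorem wS_szs : wS S u1 fv2 u2 hd2 fl2 fl3 yt (kr KR.szs) = S (kr KR.szs) := by simp [wS]
/-- Reading `na`. [folklore] -/
@[simp] theorem wS_na : wS S u1 fv2 u2 hd2 fl2 fl3 yt (kr KR.na) = S (kr KR.na) := by simp [wS]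
/-- Reading `nun`. [folklore] -/
@[simp] theorem wS_nun : wS S u1 fv2 u2 hd2 fl2 fl3 yt (kr KR.nun) = S (kr KR.nun) := by simp [wS]
/-- Reading `thr`. [folklore] -/
@[simp] theorem wS_thr : wS S u1 fv2 u2 hd2 fl2 fl3 yt (kr KR.thr) = S (kr KR.thr) := by simp [wS]
/-- Reading `ac`. [folklore] -/
@[simp] theorem wS_ac : wS S u1 fv2 u2 hd2 fl2 fl3 yt (kr KR.ac) = S (kr KR.ac) := by simp [wS]
/-- Reading `bt`. [folklore] -/
@[simp] theorem wS_bt : wS S u1 fv2 u2 hd2 fl2 fl3 yt (kr KR.bt) = S (kr KR.bt) := by simp [wS]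
/-- Reading `t1`. [folklore] -/
@[simp] theorem wS_t1 : wS S u1 fv2 u2 hd2 fl2 fl3 yt (kr KR.t1) = S (kr KR.t1) := by simp [wS]
/-- Reading `t2`. [folklore] -/
@[simp] theorem wS_t2 : wS S u1 fv2 u2 hd2 fl2 fl3 yt (kr KR.t2) = S (kr KR.t2) := by simp [wS]
/-- Reading `s7`. [folklore] -/
@[simp] theorem wS_s7 : wS S u1 fv2 u2 hd2 fl2 fl3 yt (kr KR.s7) = S (kr KR.s7) := by simp [wS]
/-- Reading `s1`. [folklore] -/
@[simp] theorem wS_s1 : wS S u1 fv2 u2 hd2 fl2 fl3 yt (kr KR.s1) = S (kr KR.s1) := by simp [wS]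
/-- Reading `s3`. [folklore] -/
@[simp] theorem wS_s3 : wS S u1 fv2 u2 hd2 fl2 fl3 yt (kr KR.s3) = S (kr KR.s3) := by simp [wS]
/-- Reading `cnt`. [folklore] -/
@[simp] theorem wS_cnt : wS S u1 fv2 u2 hd2 fl2 fl3 yt (kr KR.cnt) = S (kr KR.cnt) := by simp [wS]
/-- Reading `ytw`. [folklore] -/
@[simp] theorem wS_ytw : wS S u1 fv2 u2 hd2 fl2 fl3 yt (kr KR.ytw) = S (kr KR.ytw) := by simp [wS]
/-- Reading `ycnt`. [folklore] -/
@[simp] theorem wS_ycnt : wS S u1 fv2 u2 hd2 fl2 fl3 yt (kr KR.ycnt) = S (kr KR.ycnt) := by simp [wS]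
/-- Reading `s6`. [folklore] -/
@[simp] theorem wS_s6 : wS S u1 fv2 u2 hd2 fl2 fl3 yt (kr KR.s6) = S (kr KR.s6) := by simp [wS]
/-- Reading `fl`. [folklore] -/
@[simp] theorem wS_fl : wS S u1 fv2 u2 hd2 fl2 fl3 yt (kr KR.fl) = S (kr KR.fl) := by simp [wS]
/-- Reading `szs2`. [folklore] -/
@[simp] theorem wS_szs2 : wS S u1 fv2 u2 hd2 fl2 fl3 yt (kr KR.szs2) = S (kr KR.szs2) := by simp [wS]
/-- Reading `u3`. [folklore] -/
@[simp] theorem wS_u3 : wS S u1 fv2 u2 hd2 fl2 fl3 yt (kr KR.u3) = S (kr KR.u3) := by simp [wS]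
/-- Reading `ju`. [folklore] -/
@[simp] theorem wS_ju : wS S u1 fv2 u2 hd2 fl2 fl3 yt (kr KR.ju) = S (kr KR.ju) := by simp [wS]
/-- Reading `acc` of the emission bank. [folklore] -/
@[simp] theorem wS_tb_acc : wS S u1 fv2 u2 hd2 fl2 fl3 yt (tb TB.acc) = S (tb TB.acc) := by simp [wS]
/-- Reading `vt` of the emission bank. [folklore] -/
@[simp] theorem wS_tb_vt : wS S u1 fv2 u2 hd2 fl2 fl3 yt (tb TB.vt) = S (tb TB.vt) := by simp [wS]
/-- Updating `u1`. [folklore] -/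
@[simp] theorem update_wS_u1 : Function.update (wS S u1 fv2 u2 hd2 fl2 fl3 yt) (kr KR.u1) w = wS S w fv2 u2 hd2 fl2 fl3 yt := by
  funext r; by_cases h : r = kr KR.u1
  · subst h; simp
  · rw [Function.update_of_ne h]; simp [wS, h]
/-- Updating `fv2`. [folklore] -/
@[simp] theorem update_wS_fv2 : Function.update (wS S u1 fv2 u2 hd2 fl2 fl3 yt) (kr KR.fv2) w = wS S u1 w u2 hd2 fl2 fl3 yt := by
  funext r; by_cases h : r = kr KR.fv2
  · subst h; simp
  · rw [Function.update_of_ne h]; simp [wS, h]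
/-- Updating `u2`. [folklore] -/
@[simp] theorem update_wS_u2 : Function.update (wS S u1 fv2 u2 hd2 fl2 fl3 yt) (kr KR.u2) w = wS S u1 fv2 w hd2 fl2 fl3 yt := by
  funext r; by_cases h : r = kr KR.u2
  · subst h; simp
  · rw [Function.update_of_ne h]; simp [wS, h]
/-- Updating `hd2`. [folklore] -/
@[simp] theorem update_wS_hd2 : Function.update (wS S u1 fv2 u2 hd2 fl2 fl3 yt) (kr KR.hd2) w = wS S u1 fv2 u2 w fl2 fl3 yt := by
  funext r; by_cases h : r = kr KR.hd2
  · subst h; simp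
  · rw [Function.update_of_ne h]; simp [wS, h]
/-- Updating `fl2`. [folklore] -/
@[simp] theorem update_wS_fl2 : Function.update (wS S u1 fv2 u2 hd2 fl2 fl3 yt) (kr KR.fl2) w = wS S u1 fv2 u2 hd2 w fl3 yt := by
  funext r; by_cases h : r = kr KR.fl2
  · subst h; simp
  · rw [Function.update_of_ne h]; simp [wS, h]
/-- Updating `fl3`. [folklore] -/
@[simp] theorem update_wS_fl3 : Function.update (wS S u1 fv2 u2 hd2 fl2 fl3 yt) (kr KR.fl3) w = wS S u1 fv2 u2 hd2 fl2 w yt := by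
  funext r; by_cases h : r = kr KR.fl3
  · subst h; simp
  · rw [Function.update_of_ne h]; simp [wS, h]
/-- Updating `yt`. [folklore] -/
@[simp] theorem update_wS_yt : Function.update (wS S u1 fv2 u2 hd2 fl2 fl3 yt) (kr KR.yt) w = wS S u1 fv2 u2 hd2 fl2 fl3 w := by
  funext r; by_cases h : r = kr KR.yt
  · subst h; simp
  · rw [Function.update_of_ne h]; simp [wS, h]

end WsLemmas

/-- Every store is a `wS` over itself. [folklore] -/
theorem wS_eta (R : RStore) : wS R (R (kr KR.u1)) (R (kr KR.fv2)) (R (kr KR.u2)) (R (kr KR.hd2)) (R (kr KR.fl2)) (R (kr KR.fl3)) (R (kr KR.yt)) = R := by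
  funext r
  by_cases h0 : r = kr KR.u1; · subst h0; simp
  by_cases h1 : r = kr KR.fv2; · subst h1; simp
  by_cases h2 : r = kr KR.u2; · subst h2; simp
  by_cases h3 : r = kr KR.hd2; · subst h3; simp
  by_cases h4 : r = kr KR.fl2; · subst h4; simp
  by_cases h5 : r = kr KR.fl3; · subst h5; simp
  by_cases h6 : r = kr KR.yt; · subst h6; simp
  rw [wS_other _ _ _ _ _ _ _ _ h0 h1 h2 h3 h4 h5 h6]

/-- Updating a register outside the family passes to the base store. [folklore] -/
theorem update_wS_base (S : RStore) (u1 fv2 u2 hd2 fl2 fl3 yt : List Γ') {x : Reg} (h0 : x ≠ kr KR.u1) (h1 : x ≠ kr KR.fv2) (h2 : x ≠ kr KR.u2) (h3 : x ≠ kr KR.hd2) (h4 : x ≠ kr KR.fl2) (h5 : x ≠ kr KR.fl3) (h6 : x ≠ kr KR.yt) (u : List Γ') :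
    Function.update (wS S u1 fv2 u2 hd2 fl2 fl3 yt) x u = wS (Function.update S x u) u1 fv2 u2 hd2 fl2 fl3 yt := by
  funext r; by_cases h : r = x
  · subst h; rw [Function.update_self, wS_other _ _ _ _ _ _ _ _ h0 h1 h2 h3 h4 h5 h6, Function.update_self]
  · rw [Function.update_of_ne h]
    by_cases g0 : r = kr KR.u1
    · subst g0; simp
    by_cases g1 : r = kr KR.fv2
    · subst g1; simp
    by_cases g2 : r = kr KR.u2
    · subst g2; simp
    by_cases g3 : r = kr KR.hd2
    · subst g3; simp
    by_cases g4 : r = kr KR.fl2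
    · subst g4; simp
    by_cases g5 : r = kr KR.fl3
    · subst g5; simp
    by_cases g6 : r = kr KR.yt
    · subst g6; simp
    rw [wS_other _ _ _ _ _ _ _ _ g0 g1 g2 g3 g4 g5 g6, wS_other _ _ _ _ _ _ _ _ g0 g1 g2 g3 g4 g5 g6, Function.update_of_ne h]

/-! ### The base hypotheses of this level -/

/-- What one disjunct needs of the work registers: the annotated clauses, block table, block sizes
and `A`-count of the mask, the current `f`-vector, `n` and the threshold in unary, and every
scratch register of every sub-phase empty. [folklore] -/
structure VBase (T : AStore Γ' KR) (P : Params) (F : List (List (ℕ × Bool))) (n t : ℕ) (ss ds : List ℕ) : Prop where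
  /-- data -/
  ac : T KR.ac = wAC P F
  /-- data -/
  bt : T KR.bt = wBT (btab P F)
  /-- data -/
  szs : T KR.szs = dW ss
  /-- data -/
  fv : T KR.fv = dW ds
  /-- data -/
  na : T KR.na = bitsN (aList P F).length
  /-- data -/
  nun : T KR.nun = ticks Γ'.blank n
  /-- data -/
  thr : T KR.thr = ticks Γ'.blank t
  /-- scratch -/
  vw : T KR.vw = []
  /-- scratch -/
  fnd : T KR.fnd = []
  /-- scratch -/
  ex : T KR.ex = []
  /-- scratch -/
  eb : T KR.eb = []
  /-- scratch -/
  lmd : T KR.lmd = []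
  /-- scratch -/
  ne : T KR.ne = []
  /-- scratch -/
  x2 : T KR.x2 = []
  /-- scratch -/
  t1 : T KR.t1 = []
  /-- scratch -/
  t2 : T KR.t2 = []
  /-- scratch -/
  btw : T KR.btw = []
  /-- scratch -/
  md2 : T KR.md2 = []
  /-- scratch -/
  pt : T KR.pt = []
  /-- scratch -/
  pf : T KR.pf = []
  /-- scratch -/
  lpol : T KR.lpol = []
  /-- scratch -/
  allf : T KR.allf = []
  /-- scratch -/
  ft : T KR.ft = []
  /-- scratch -/
  ff : T KR.ff = []
  /-- scratch -/
  gt : T KR.gt = []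
  /-- scratch -/
  gf : T KR.gf = []
  /-- scratch -/
  done : T KR.done = []
  /-- scratch -/
  ru : T KR.ru = []
  /-- scratch -/
  cntf : T KR.cntf = []
  /-- scratch -/
  ytw : T KR.ytw = []
  /-- scratch -/
  yv : T KR.yv = []
  /-- scratch -/
  clw : T KR.clw = []
  /-- scratch -/
  md : T KR.md = []
  /-- scratch -/
  pol : T KR.pol = []
  /-- scratch -/
  tag : T KR.tag = []
  /-- scratch -/
  pr : T KR.pr = []
  /-- scratch -/
  blk : T KR.blk = []
  /-- scratch -/
  iu2 : T KR.iu2 = []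
  /-- scratch -/
  pos : T KR.pos = []
  /-- scratch -/
  res : T KR.res = []
  /-- scratch -/
  val : T KR.val = []
  /-- scratch -/
  cl : T KR.cl = []
  /-- scratch -/
  c2 : T KR.c2 = []
  /-- scratch -/
  u1 : T KR.u1 = []
  /-- scratch -/
  fl2 : T KR.fl2 = []
  /-- scratch -/
  fl3 : T KR.fl3 = []
  /-- scratch -/
  iu : T KR.iu = []
  /-- scratch -/
  s0 : T KR.s0 = []
  /-- scratch -/
  ac2 : T KR.ac2 = []
  /-- scratch -/
  s7 : T KR.s7 = []
  /-- scratch -/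
  s1 : T KR.s1 = []
  /-- scratch -/
  s3 : T KR.s3 = []
  /-- scratch -/
  u2 : T KR.u2 = []
  /-- scratch -/
  cnt : T KR.cnt = []
  /-- scratch -/
  ycnt : T KR.ycnt = []
  /-- scratch -/
  s6 : T KR.s6 = []
  /-- scratch -/
  fl : T KR.fl = []
  /-- scratch -/
  fv2 : T KR.fv2 = []
  /-- scratch -/
  szs2 : T KR.szs2 = []
  /-- scratch -/
  yt : T KR.yt = []
  /-- scratch -/
  u3 : T KR.u3 = []
  /-- scratch -/
  ju : T KR.ju = []
  /-- scratch -/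
  hd2 : T KR.hd2 = []
  /-- scratch -/
  s4 : T KR.s4 = []

/-- After the `Y`-table is in place, `emitOut` may run (`IPRenameDrivers.lean`). [folklore] -/
theorem VBase.emitBase {T : AStore Γ' KR} {P : Params} {F : List (List (ℕ × Bool))} {n t : ℕ} {ss ds : List ℕ}
    (h : VBase T P F n t ss ds) : EmitBase (Function.update T KR.yt (wYT (ytab P F))) P F :=
  { kb := { vw := by rw [Function.update_of_ne (by decide)]; exact h.vw, fnd := by rw [Function.update_of_ne (by decide)]; exact h.fnd, ex := by rw [Function.update_of_ne (by decide)]; exact h.ex, eb := by rw [Function.update_of_ne (by decide)]; exact h.eb, lmd := by rw [Function.update_of_ne (by decide)]; exact h.lmd, ne := by rw [Function.update_of_ne (by decide)]; exact h.ne, x2 := by rw [Function.update_of_ne (by decide)]; exact h.x2, t1 := by rw [Function.update_of_ne (by decide)]; exact h.t1, t2 := by rw [Function.update_of_ne (by decide)]; exact h.t2, btw := by rw [Function.update_of_ne (by decide)]; exact h.btw, md2 := by rw [Function.update_of_ne (by decide)]; exact h.md2, pt := by rw [Function.update_of_ne (by decide)]; exact h.pt, pf := by rw [Function.update_of_ne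 (by decide)]; exact h.pf, lpol := by rw [Function.update_of_ne (by decide)]; exact h.lpol, allf := by rw [Function.update_of_ne (by decide)]; exact h.allf, ft := by rw [Function.update_of_ne (by decide)]; exact h.ft, ff := by rw [Function.update_of_ne (by decide)]; exact h.ff, gt := by rw [Function.update_of_ne (by decide)]; exact h.gt, gf := by rw [Function.update_of_ne (by decide)]; exact h.gf, done := by rw [Function.update_of_ne (by decide)]; exact h.done, ru := by rw [Function.update_of_ne (by decide)]; exact h.ru, cntf := by rw [Function.update_of_ne (by decide)]; exact h.cntf, ytw := by rw [Function.update_of_ne (by decide)]; exact h.ytw, yv := by rw [Function.update_of_ne (by decide)]; exact h.yv, bt := by rw [Function.update_of_ne (by decide)]; exact h.bt, yt := by rw [Function.update_self] },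
    sc := { clw := by rw [Function.update_of_ne (by decide)]; exact h.clw, md := by rw [Function.update_of_ne (by decide)]; exact h.md, pol := by rw [Function.update_of_ne (by decide)]; exact h.pol, tag := by rw [Function.update_of_ne (by decide)]; exact h.tag, pr := by rw [Function.update_of_ne (by decide)]; exact h.pr, blk := by rw [Function.update_of_ne (by decide)]; exact h.blk, iu2 := by rw [Function.update_of_ne (by decide)]; exact h.iu2, pos := by rw [Function.update_of_ne (by decide)]; exact h.pos, res := by rw [Function.update_of_ne (by decide)]; exact h.res, val := by rw [Function.update_of_ne (by decide)]; exact h.val },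
    cl := by rw [Function.update_of_ne (by decide)]; exact h.cl, c2 := by rw [Function.update_of_ne (by decide)]; exact h.c2, u1 := by rw [Function.update_of_ne (by decide)]; exact h.u1, fl2 := by rw [Function.update_of_ne (by decide)]; exact h.fl2, fl3 := by rw [Function.update_of_ne (by decide)]; exact h.fl3, iu := by rw [Function.update_of_ne (by decide)]; exact h.iu, s0 := by rw [Function.update_of_ne (by decide)]; exact h.s0, ac2 := by rw [Function.update_of_ne (by decide)]; exact h.ac2, ac := by rw [Function.update_of_ne (by decide)]; exact h.ac }

/-- `VBase` with a new `f`-vector. [folklore] -/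
theorem VBase.upd_fv {T : AStore Γ' KR} {P : Params} {F : List (List (ℕ × Bool))} {n t : ℕ} {ss ds : List ℕ}
    (h : VBase T P F n t ss ds) (ds' : List ℕ) : VBase (Function.update T KR.fv (dW ds')) P F n t ss ds' :=
  { ac := by rw [Function.update_of_ne (by decide)]; exact h.ac, bt := by rw [Function.update_of_ne (by decide)]; exact h.bt, szs := by rw [Function.update_of_ne (by decide)]; exact h.szs, fv := by rw [Function.update_self], na := by rw [Function.update_of_ne (by decide)]; exact h.na, nun := by rw [Function.update_of_ne (by decide)]; exact h.nun, thr := by rw [Function.update_of_ne (by decide)]; exact h.thr, vw := by rw [Function.update_of_ne (by decide)]; exact h.vw, fnd := by rw [Function.update_of_ne (by decide)]; exact h.fnd, ex := by rw [Function.update_of_ne (by decide)]; exact h.ex, eb := by rw [Function.update_of_ne (by decide)]; exact h.eb, lmd := by rw [Function.update_of_ne (by decide)]; exact h.lmd, ne := by rw [Function.update_of_ne (by decide)]; exact h.ne, x2 := by rw [Function.update_of_ne (by decide)]; exact h.x2, t1 := by rw [Function.update_of_ne (by decide)]; exact h.t1, t2 := by rw [Function.update_of_ne (by decide)]; exact h.t2,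 btw := by rw [Function.update_of_ne (by decide)]; exact h.btw, md2 := by rw [Function.update_of_ne (by decide)]; exact h.md2, pt := by rw [Function.update_of_ne (by decide)]; exact h.pt, pf := by rw [Function.update_of_ne (by decide)]; exact h.pf, lpol := by rw [Function.update_of_ne (by decide)]; exact h.lpol, allf := by rw [Function.update_of_ne (by decide)]; exact h.allf, ft := by rw [Function.update_of_ne (by decide)]; exact h.ft, ff := by rw [Function.update_of_ne (by decide)]; exact h.ff, gt := by rw [Function.update_of_ne (by decide)]; exact h.gt, gf := by rw [Function.update_of_ne (by decide)]; exact h.gf, done := by rw [Function.update_of_ne (by decide)]; exact h.done, ru := by rw [Function.update_of_ne (by decide)]; exact h.ru, cntf := by rw [Function.update_of_ne (by decide)]; exact h.cntf, ytw := by rw [Function.update_of_ne (by decide)]; exact h.ytw, yv := by rw [Function.update_of_ne (by decide)]; exact h.yv, clw := by rw [Function.update_of_ne (by decide)]; exact h.clw, md := by rw [Function.update_of_ne (by decide)]; exact h.md, pol := by rw [Function.update_of_ne (by decide)]; exact h.pol, tag := by rw [Function.update_of_ne (by decide)]; exact h.tag, pr := by rw [Function.update_of_ne (by decide)]; exact h.pr,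 blk := by rw [Function.update_of_ne (by decide)]; exact h.blk, iu2 := by rw [Function.update_of_ne (by decide)]; exact h.iu2, pos := by rw [Function.update_of_ne (by decide)]; exact h.pos, res := by rw [Function.update_of_ne (by decide)]; exact h.res, val := by rw [Function.update_of_ne (by decide)]; exact h.val, cl := by rw [Function.update_of_ne (by decide)]; exact h.cl, c2 := by rw [Function.update_of_ne (by decide)]; exact h.c2, u1 := by rw [Function.update_of_ne (by decide)]; exact h.u1, fl2 := by rw [Function.update_of_ne (by decide)]; exact h.fl2, fl3 := by rw [Function.update_of_ne (by decide)]; exact h.fl3, iu := by rw [Function.update_of_ne (by decide)]; exact h.iu, s0 := by rw [Function.update_of_ne (by decide)]; exact h.s0, ac2 := by rw [Function.update_of_ne (by decide)]; exact h.ac2, s7 := by rw [Function.update_of_ne (by decide)]; exact h.s7, s1 := by rw [Function.update_of_ne (by decide)]; exact h.s1, s3 := by rw [Function.update_of_ne (by decide)]; exact h.s3, u2 := by rw [Function.update_of_ne (by decide)]; exact h.u2, cnt := by rw [Function.update_of_ne (by decide)]; exact h.cnt, ycnt := by rw [Function.update_of_ne (by decide)]; exact h.ycnt, s6 := by rw [Function.update_of_ne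 (by decide)]; exact h.s6, fl := by rw [Function.update_of_ne (by decide)]; exact h.fl, fv2 := by rw [Function.update_of_ne (by decide)]; exact h.fv2, szs2 := by rw [Function.update_of_ne (by decide)]; exact h.szs2, yt := by rw [Function.update_of_ne (by decide)]; exact h.yt, u3 := by rw [Function.update_of_ne (by decide)]; exact h.u3, ju := by rw [Function.update_of_ne (by decide)]; exact h.ju, hd2 := by rw [Function.update_of_ne (by decide)]; exact h.hd2, s4 := by rw [Function.update_of_ne (by decide)]; exact h.s4 }

/-- `VBase` survives resetting the loop register `s4`. [folklore] -/
theorem VBase.upd_s4 {T : AStore Γ' KR} {P : Params} {F : List (List (ℕ × Bool))} {n t : ℕ} {ss ds : List ℕ}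
    (h : VBase T P F n t ss ds) : VBase (Function.update T KR.s4 []) P F n t ss ds :=
  { ac := by rw [Function.update_of_ne (by decide)]; exact h.ac, bt := by rw [Function.update_of_ne (by decide)]; exact h.bt, szs := by rw [Function.update_of_ne (by decide)]; exact h.szs, fv := by rw [Function.update_of_ne (by decide)]; exact h.fv, na := by rw [Function.update_of_ne (by decide)]; exact h.na, nun := by rw [Function.update_of_ne (by decide)]; exact h.nun, thr := by rw [Function.update_of_ne (by decide)]; exact h.thr, vw := by rw [Function.update_of_ne (by decide)]; exact h.vw, fnd := by rw [Function.update_of_ne (by decide)]; exact h.fnd, ex := by rw [Function.update_of_ne (by decide)]; exact h.ex, eb := by rw [Function.update_of_ne (by decide)]; exact h.eb, lmd := by rw [Function.update_of_ne (by decide)]; exact h.lmd, ne := by rw [Function.update_of_ne (by decide)]; exact h.ne, x2 := by rw [Function.update_of_ne (by decide)]; exact h.x2, t1 := by rw [Function.update_of_ne (by decide)]; exact h.t1, t2 := by rw [Function.update_of_ne (by decide)]; exact h.t2, btw := by rw [Function.update_of_ne (by decide)]; exact h.btw, md2 := by rw [Function.update_of_ne (by decide)]; exact h.md2, pt := by rw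 [Function.update_of_ne (by decide)]; exact h.pt, pf := by rw [Function.update_of_ne (by decide)]; exact h.pf, lpol := by rw [Function.update_of_ne (by decide)]; exact h.lpol, allf := by rw [Function.update_of_ne (by decide)]; exact h.allf, ft := by rw [Function.update_of_ne (by decide)]; exact h.ft, ff := by rw [Function.update_of_ne (by decide)]; exact h.ff, gt := by rw [Function.update_of_ne (by decide)]; exact h.gt, gf := by rw [Function.update_of_ne (by decide)]; exact h.gf, done := by rw [Function.update_of_ne (by decide)]; exact h.done, ru := by rw [Function.update_of_ne (by decide)]; exact h.ru, cntf := by rw [Function.update_of_ne (by decide)]; exact h.cntf, ytw := by rw [Function.update_of_ne (by decide)]; exact h.ytw, yv := by rw [Function.update_of_ne (by decide)]; exact h.yv, clw := by rw [Function.update_of_ne (by decide)]; exact h.clw, md := by rw [Function.update_of_ne (by decide)]; exact h.md, pol := by rw [Function.update_of_ne (by decide)]; exact h.pol, tag := by rw [Function.update_of_ne (by decide)]; exact h.tag, pr := by rw [Function.update_of_ne (by decide)]; exact h.pr, blk := by rw [Function.update_of_ne (by decide)]; exact h.blk, iu2 := by rw [Function.update_of_ne (by decide)]; exact h.iu2,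 pos := by rw [Function.update_of_ne (by decide)]; exact h.pos, res := by rw [Function.update_of_ne (by decide)]; exact h.res, val := by rw [Function.update_of_ne (by decide)]; exact h.val, cl := by rw [Function.update_of_ne (by decide)]; exact h.cl, c2 := by rw [Function.update_of_ne (by decide)]; exact h.c2, u1 := by rw [Function.update_of_ne (by decide)]; exact h.u1, fl2 := by rw [Function.update_of_ne (by decide)]; exact h.fl2, fl3 := by rw [Function.update_of_ne (by decide)]; exact h.fl3, iu := by rw [Function.update_of_ne (by decide)]; exact h.iu, s0 := by rw [Function.update_of_ne (by decide)]; exact h.s0, ac2 := by rw [Function.update_of_ne (by decide)]; exact h.ac2, s7 := by rw [Function.update_of_ne (by decide)]; exact h.s7, s1 := by rw [Function.update_of_ne (by decide)]; exact h.s1, s3 := by rw [Function.update_of_ne (by decide)]; exact h.s3, u2 := by rw [Function.update_of_ne (by decide)]; exact h.u2, cnt := by rw [Function.update_of_ne (by decide)]; exact h.cnt, ycnt := by rw [Function.update_of_ne (by decide)]; exact h.ycnt, s6 := by rw [Function.update_of_ne (by decide)]; exact h.s6, fl := by rw [Function.update_of_ne (by decide)]; exact h.fl, fv2 := by rw [Function.update_of_ne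 (by decide)]; exact h.fv2, szs2 := by rw [Function.update_of_ne (by decide)]; exact h.szs2, yt := by rw [Function.update_of_ne (by decide)]; exact h.yt, u3 := by rw [Function.update_of_ne (by decide)]; exact h.u3, ju := by rw [Function.update_of_ne (by decide)]; exact h.ju, hd2 := by rw [Function.update_of_ne (by decide)]; exact h.hd2, s4 := by rw [Function.update_self] }


/-! ### The header of a disjunct -/

/-- The digit sum of an `f`-vector is at most the length of its word. [folklore] -/
theorem sum_le_length_dW : ∀ ds : List ℕ, ds.sum ≤ (dW ds).length
  | [] => by simp
  | d :: ds => by rw [length_dW_cons, List.sum_cons]; have := sum_le_length_dW ds; omega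

/-- Emit the header of the current disjunct — `n - Σ ds` in binary, then a comma — reversed onto
the accumulator (`n` in unary in `nun`, kept; the digit sum of the `f`-vector `fv`, kept).
[folklore] -/
def hdrEmit : RProg :=
  copyToG (kr KR.nun) (kr KR.u1) (kr KR.t1) (kr KR.t2) ;;
  copyToG (kr KR.fv) (kr KR.fv2) (kr KR.t1) (kr KR.t2) ;; tallyB (kr KR.fv2) (kr KR.u2) ;;
  pairOff (kr KR.u2) (kr KR.u1) ;; toBinG (kr KR.u1) (kr KR.hd2) (kr KR.t1) (kr KR.t2) ;;
  pour (kr KR.hd2) (tb TB.acc) ;; push (tb TB.acc) Γ'.comma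

/-- The cost of `hdrEmit` in terms of `n` and the length `D` of the `f`-vector word. [folklore] -/
def hdrCost (n D : ℕ) : ℕ := (9 * n + 11) * n + 13 * n + 17 * D + 11

section VecSpec

variable {T : AStore Γ' KR} {P : Params} {F : List (List (ℕ × Bool))} {n t : ℕ} {ss ds : List ℕ}
  (hV : VBase T P F n t ss ds)
include hV

/-- With the temporaries empty, the family store is the level store. [folklore] -/
theorem wS_vS (acc : List Γ') : wS (vS acc T) [] [] [] [] [] [] [] = vS acc T := by
  have e := wS_eta (vS acc T)
  simp only [vS_kr, hV.u1, hV.fv2, hV.u2, hV.hd2, hV.fl2, hV.fl3, hV.yt] at e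
  exact e

/-- **`hdrEmit`.** [folklore] -/
theorem runs_hdrEmit (acc : List Γ') :
    Runs hdrEmit (vS acc T) (vS (Γ'.comma :: ((bitsN (n - ds.sum)).reverse ++ acc)) T) (hdrCost n (dW ds).length) := by
  rw [← wS_vS hV acc]
  unfold hdrEmit
  -- 1. copy `n`
  have h1 := runs_copyToG (a := kr KR.nun) (b := kr KR.u1) (t₁ := kr KR.t1) (t₂ := kr KR.t2) (by simp) (by simp) (by simp) (by simp) (by simp) (by simp)
    (wS (vS acc T) [] [] [] [] [] [] []) (by simp [hV.t1]) (by simp [hV.t2]) (by simp)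
  rw [wS_nun, vS_kr, hV.nun, update_wS_u1] at h1
  -- 2. copy the `f`-vector
  have h2 := runs_copyToG (a := kr KR.fv) (b := kr KR.fv2) (t₁ := kr KR.t1) (t₂ := kr KR.t2) (by simp) (by simp) (by simp) (by simp) (by simp) (by simp)
    (wS (vS acc T) (ticks Γ'.blank n) [] [] [] [] [] []) (by simp [hV.t1]) (by simp [hV.t2]) (by simp)
  rw [wS_fv, vS_kr, hV.fv, update_wS_fv2] at h2
  -- 3. its digit sum
  have h3 := runs_tallyB (src := kr KR.fv2) (dst := kr KR.u2) (by simp) (dW ds) (wS (vS acc T) (ticks Γ'.blank n) (dW ds) [] [] [] [] []) (by simp)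
  rw [update_wS_fv2, wS_u2, List.append_nil, update_wS_u2, count_blank_dW] at h3
  -- 4. subtract
  have h4 := runs_pairOff (a := kr KR.u2) (b := kr KR.u1) (by simp) ds.sum n (wS (vS acc T) (ticks Γ'.blank n) [] (ticks Γ'.blank ds.sum) [] [] [] []) (by simp) (by simp)
  rw [update_wS_u2, update_wS_u1] at h4
  -- 5. to binary
  have h5 := runs_toBinG (u := kr KR.u1) (c := kr KR.hd2) (f := kr KR.t1) (j := kr KR.t2) (by simp) (by simp) (by simp) (by simp) (by simp) (by simp)
    (n - ds.sum) 0 (wS (vS acc T) (ticks Γ'.blank (n - ds.sum)) [] [] [] [] [] []) (by simp)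
    (by rw [wS_hd2]; exact (congrArg (List.map Γ'.bit) TokConv.encodeNat_zero').symm) (by simp [hV.t1]) (by simp [hV.t2])
  rw [update_wS_u1, update_wS_hd2, Nat.zero_add] at h5
  -- 6. pour the header, reversed, onto the accumulator
  have h6 := runs_pour (a := kr KR.hd2) (b := tb TB.acc) (by simp) (wS (vS acc T) [] [] [] (bitsN (n - ds.sum)) [] [] [])
  rw [wS_hd2, update_wS_hd2, wS_tb_acc, vS_acc,
    update_wS_base _ _ _ _ _ _ _ _ (by simp) (by simp) (by simp) (by simp) (by simp) (by simp) (by simp), update_vS_acc] at h6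
  -- 7. the comma
  have h7 : Runs (push (tb TB.acc) Γ'.comma) (wS (vS ((bitsN (n - ds.sum)).reverse ++ acc) T) [] [] [] [] [] [] [])
      (wS (vS (Γ'.comma :: ((bitsN (n - ds.sum)).reverse ++ acc)) T) [] [] [] [] [] [] []) 1 :=
    Runs.push' (by
      rw [wS_tb_acc, vS_acc, update_wS_base _ _ _ _ _ _ _ _ (by simp) (by simp) (by simp) (by simp) (by simp) (by simp) (by simp),
        update_vS_acc])
  refine (h1.seq (h2.seq (h3.seq (h4.seq (h5.seq (h6.seq h7)))))).of_eq (wS_vS hV _) ?_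
  have a1 : (9 * (n - ds.sum) + 11) * (n - ds.sum) ≤ (9 * n + 11) * n := Nat.mul_le_mul (by omega) (by omega)
  have a2 := sum_le_length_dW ds
  have a3 : (bitsN (n - ds.sum)).length ≤ n := (length_bitsN_le _).trans (Nat.sub_le _ _)
  simp only [length_ticks]
  unfold hdrCost
  omega

end VecSpec

/-! ### One disjunct: `Y`-table, header, clauses -/

/-- Emit the current disjunct: header, `Y`-table, the clauses of `reduce P φ` (`emitOut`), the
closing blank; then clear the `Y`-table. [folklore] -/
def vecEmit (m : ℕ) : RProg :=
  hdrEmit ;; ytBuild m ;; emitOut ;; push (tb TB.acc) Γ'.blank ;; clear (kr KR.yt)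

/-- The word pushed (reversed) for one disjunct: header, comma, clauses, blank. [folklore] -/
def vecW (P : Params) (F : List (List (ℕ × Bool))) (n : ℕ) (ds : List ℕ) : List Γ' :=
  bitsN (n - ds.sum) ++ Γ'.comma :: (wFam (outClauses P F) ++ [Γ'.blank])

/-- The cost of `vecEmit`. [folklore] -/
def vecEmitCost (P : Params) (F : List (List (ℕ × Bool))) (m n Y : ℕ) (ds ss : List ℕ) : ℕ :=
  hdrCost n (dW ds).length + ytCost m Y ds.length (dW ds).length (dW ss).length (bitsN (aList P F).length).length +
    emitOutCost P F + 1 + (2 * (wYT (ytab P F)).length + 1)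

/-- The threshold test and, if it succeeds, the disjunct: the digit sum of the `f`-vector (by a
tally of a copy) is compared with the unary threshold `thr` (by `cmpU` on copies). [folklore] -/
def vecStep (m : ℕ) : RProg :=
  copyToG (kr KR.fv) (kr KR.fv2) (kr KR.t1) (kr KR.t2) ;; tallyB (kr KR.fv2) (kr KR.u1) ;;
  copyToG (kr KR.thr) (kr KR.u2) (kr KR.t1) (kr KR.t2) ;;
  cmpU (kr KR.u1) (kr KR.u2) (kr KR.fl2) (kr KR.fl3) Γ'.blank ;; clear (kr KR.fl2) ;;
  pop (kr KR.fl3) fun o => match o with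
    | some _ => skip
    | none => vecEmit m

/-- The cost of `vecStep`. [folklore] -/
def vecStepCost (P : Params) (F : List (List (ℕ × Bool))) (m n t Y : ℕ) (ds ss : List ℕ) : ℕ :=
  vecEmitCost P F m n Y ds ss + 22 * (dW ds).length + 12 * t + 21

/-- The machine's `Y`-table for the vector `ds` (last block first) is the `Y`-table of `P` when
`P.fv = ds.reverse` is dominated by the sizes of the nonempty blocks. [folklore] -/
theorem ytW_eq_wYT' (P : Params) (F : List (List (ℕ × Bool))) {ds ss : List ℕ} (hfv : P.fv = ds.reverse)
    (hss : ss = (sizesNB P F).reverse) (hdom : List.Forall₂ (· ≤ ·) ds ss) :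
    ytW ds.reverse ss.reverse (aList P F).length = wYT (ytab P F) := by
  have e1 : ss.reverse = sizesNB P F := by rw [hss, List.reverse_reverse]
  have hlen : P.fv.length = numNB P F := by
    rw [hfv, List.length_reverse, hdom.length_eq, ← List.length_reverse, e1]; simp [sizesNB]
  have hdom' : List.Forall₂ (· ≤ ·) P.fv (sizesNB P F) := by
    rw [hfv, ← e1]; exact List.forall₂_reverse_iff.2 hdom
  rw [e1, ← hfv]
  exact ytW_eq_wYT P F hlen hdom'

/-- The store of the threshold comparison is a `cmpSt`. [folklore] -/
theorem wS_eq_cmpSt (T : AStore Γ' KR) (acc : List Γ') (i j : ℕ) :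
    wS (vS acc T) (ticks Γ'.blank i) [] (ticks Γ'.blank j) [] [] [] [] =
      cmpSt (kr KR.u1) (kr KR.u2) (kr KR.fl2) Γ'.blank (wS (vS acc T) [] [] [] [] [] [] []) i j False := by
  simp [cmpSt, ticks]

section VecSpec2

variable {T : AStore Γ' KR} {P : Params} {F : List (List (ℕ × Bool))} {n t m : ℕ} {ss ds : List ℕ}
  (hV : VBase T P F n t ss ds) (hfv : P.fv = ds.reverse) (hss : ss = (sizesNB P F).reverse)
  (hdom : List.Forall₂ (· ≤ ·) ds ss) (hm : ∀ s ∈ ss, s ≤ m) (Y : ℕ) (hY : (aList P F).length + ss.sum ≤ Y)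
include hV hfv hss hdom hm hY

/-- **`vecEmit`**: the word of the disjunct is pushed, reversed, onto the accumulator; every other
register is restored. [folklore] -/
theorem runs_vecEmit (acc : List Γ') :
    Runs (vecEmit m) (vS acc T) (vS ((vecW P F n ds).reverse ++ acc) T) (vecEmitCost P F m n Y ds ss) := by
  unfold vecEmit
  -- 1. header
  have h1 := runs_hdrEmit hV acc
  set acc1 := Γ'.comma :: ((bitsN (n - ds.sum)).reverse ++ acc) with hacc1
  -- 2. the `Y`-table
  have h2 := runs_ytBuild (vS acc1 T) m ds ss (aList P F).length Y hdom hm hY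
    (by simp [hV.fv]) (by simp [hV.szs]) (by simp [hV.na]) (by simp [hV.t1]) (by simp [hV.t2]) (by simp [hV.fl2]) (by simp [hV.s7])
    (by simp [hV.s1]) (by simp [hV.s3]) (by simp [hV.u1]) (by simp [hV.u2]) (by simp [hV.cnt]) (by simp [hV.ytw]) (by simp [hV.ycnt])
    (by simp [hV.s6]) (by simp [hV.fl]) (by simp [hV.fv2]) (by simp [hV.szs2]) (by simp [hV.yt])
  rw [update_vS_kr, ytW_eq_wYT' P F hfv hss hdom] at h2
  set T1 := Function.update T KR.yt (wYT (ytab P F)) with hT1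
  -- 3. the clauses
  have h3 := runs_emitOut P F T1 hV.emitBase acc1
  rw [← vS_eq, ← vS_eq] at h3
  set acc2 := (wFam (outClauses P F)).reverse ++ acc1 with hacc2
  -- 4. the closing blank
  have h4 : Runs (push (tb TB.acc) Γ'.blank) (vS acc2 T1) (vS (Γ'.blank :: acc2) T1) 1 := Runs.push' (by simp)
  -- 5. clear the `Y`-table
  have h5 := runs_clear (kr KR.yt) (vS (Γ'.blank :: acc2) T1)
  have eyt : vS (Γ'.blank :: acc2) T1 (kr KR.yt) = wYT (ytab P F) := by simp [hT1]
  have eT : Function.update T1 KR.yt [] = T := by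
    rw [hT1, Function.update_idem]; exact Function.update_eq_self_iff.2 hV.yt.symm
  rw [eyt, update_vS_kr, eT] at h5
  refine (h1.seq (h2.seq (h3.seq (h4.seq h5)))).of_eq ?_ ?_
  · simp [hacc2, hacc1, vecW, List.reverse_append]
  · unfold vecEmitCost; omega

/-- **`vecStep`**: if the threshold test `t ≤ Σ ds` succeeds, the word of the disjunct is pushed,
reversed, onto the accumulator; in both cases every other register is restored. [folklore] -/
theorem runs_vecStep (acc : List Γ') :
    Runs (vecStep m) (vS acc T) (vS ((if t ≤ ds.sum then (vecW P F n ds).reverse else []) ++ acc) T)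
      (vecStepCost P F m n t Y ds ss) := by
  rw [← wS_vS hV acc]
  unfold vecStep
  -- 1. copy the `f`-vector
  have h1 := runs_copyToG (a := kr KR.fv) (b := kr KR.fv2) (t₁ := kr KR.t1) (t₂ := kr KR.t2) (by simp) (by simp) (by simp) (by simp) (by simp) (by simp)
    (wS (vS acc T) [] [] [] [] [] [] []) (by simp [hV.t1]) (by simp [hV.t2]) (by simp)
  rw [wS_fv, vS_kr, hV.fv, update_wS_fv2] at h1
  -- 2. its digit sum
  have h2 := runs_tallyB (src := kr KR.fv2) (dst := kr KR.u1) (by simp) (dW ds) (wS (vS acc T) [] (dW ds) [] [] [] [] []) (by simp)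
  rw [update_wS_fv2, wS_u1, List.append_nil, update_wS_u1, count_blank_dW] at h2
  -- 3. copy the threshold
  have h3 := runs_copyToG (a := kr KR.thr) (b := kr KR.u2) (t₁ := kr KR.t1) (t₂ := kr KR.t2) (by simp) (by simp) (by simp) (by simp) (by simp) (by simp)
    (wS (vS acc T) (ticks Γ'.blank ds.sum) [] [] [] [] [] []) (by simp [hV.t1]) (by simp [hV.t2]) (by simp)
  rw [wS_thr, vS_kr, hV.thr, update_wS_u2] at h3
  -- 4. compare
  have h4 := runs_cmpU (a := kr KR.u1) (b := kr KR.u2) (gt := kr KR.fl2) (lt := kr KR.fl3) (by simp) (by simp) (by simp) (by simp) (by simp) (by simp)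
    Γ'.blank (wS (vS acc T) [] [] [] [] [] [] []) ds.sum t False False (by simp)
  rw [← wS_eq_cmpSt T acc ds.sum t] at h4
  simp only [cmpSt, List.replicate_zero, false_or, update_wS_u1, update_wS_u2, update_wS_fl2, update_wS_fl3] at h4
  -- 5. drop the first flag
  have h5 := runs_clear (kr KR.fl2) (wS (vS acc T) [] [] [] [] (flagW Γ'.blank (t < ds.sum)) (flagW Γ'.blank (ds.sum < t)) [])
  rw [wS_fl2, update_wS_fl2] at h5
  have hl5 : (flagW Γ'.blank (t < ds.sum)).length ≤ 1 := length_flagW_le _ _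
  -- 6. branch on the second flag
  by_cases hlt : ds.sum < t
  · have h6 : Runs (pop (kr KR.fl3) fun o => match o with
        | some _ => skip
        | none => vecEmit m) (wS (vS acc T) [] [] [] [] [] (flagW Γ'.blank (ds.sum < t)) []) (wS (vS acc T) [] [] [] [] [] [] []) 2 :=
      Runs.pop_cons (k := kr KR.fl3) (a := Γ'.blank) (w := []) (by simp [hlt]) ((Runs.skip _).of_eq (by simp) le_rfl)
    refine (h1.seq (h2.seq (h3.seq (h4.seq (h5.seq h6))))).of_eq ?_ ?_
    · rw [if_neg (by omega), List.nil_append, wS_vS hV]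
    · have a2 := sum_le_length_dW ds
      simp only [length_ticks]; unfold vecStepCost; omega
  · have h6 : Runs (pop (kr KR.fl3) fun o => match o with
        | some _ => skip
        | none => vecEmit m) (wS (vS acc T) [] [] [] [] [] (flagW Γ'.blank (ds.sum < t)) [])
        (vS ((vecW P F n ds).reverse ++ acc) T) (vecEmitCost P F m n Y ds ss + 2) := by
      refine Runs.pop_nil (k := kr KR.fl3) (by simp [hlt]) ?_
      have e : wS (vS acc T) [] [] [] [] [] (flagW Γ'.blank (ds.sum < t)) [] = vS acc T := by rw [flagW_false _ hlt]; exact wS_vS hV acc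
      rw [e]; exact runs_vecEmit hV hfv hss hdom hm Y hY acc
    refine (h1.seq (h2.seq (h3.seq (h4.seq (h5.seq h6))))).of_eq ?_ ?_
    · rw [if_pos (by omega)]
    · have a2 := sum_le_length_dW ds
      simp only [length_ticks]; unfold vecStepCost; omega

end VecSpec2

/-! ### The emitted word is the encoding of the disjunct -/

/-- With an `f`-vector of length `numNB` dominated by the nonempty block sizes, `fSum` is its plain
sum. [folklore] -/
theorem fSum_eq_sum_of_numNB (P : Params) (F : List (List (ℕ × Bool))) (hlen : P.fv.length = numNB P F)
    (hdom : List.Forall₂ (· ≤ ·) P.fv (sizesNB P F)) : fSum P F = P.fv.sum := by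
  unfold fSum
  obtain ⟨j, hj⟩ : ∃ j, numBlocks P F = numNB P F + j := ⟨numBlocks P F - numNB P F, by have := numNB_le_numBlocks P F; omega⟩
  rw [hj, List.range_add, List.map_append, List.sum_append]
  have h2 : (((List.range j).map (numNB P F + ·)).map (fAt P F)).sum = 0 := by
    refine List.sum_eq_zero fun x hx => ?_
    rw [List.map_map] at hx
    obtain ⟨i, -, rfl⟩ := List.mem_map.1 hx
    simp only [Function.comp_apply]
    unfold fAt
    rw [block_eq_nil_of_numNB_le P F (by omega)]
    simp
  have h1 : (List.range (numNB P F)).map (fAt P F) = P.fv := by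
    refine List.ext_getElem (by simp [hlen]) fun i hi1 hi2 => ?_
    simp only [List.getElem_map, List.getElem_range]
    exact fAt_eq_getElem P F hlen hdom i (by simpa using hi1)
  rw [h2, h1, Nat.add_zero]

/-- **The word of a disjunct is the encoding of `reduce P φ`, closed by a blank.** [folklore] -/
theorem vecW_eq {k : ℕ} (φ : KCNF k) (P : Params) {ds ss : List ℕ} (hfv : P.fv = ds.reverse)
    (hss : ss = (sizesNB P φ.clauses).reverse) (hdom : List.Forall₂ (· ≤ ·) ds ss) :
    vecW P φ.clauses φ.numVars ds = (reduce P φ).encode ++ [Γ'.blank] := by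
  have e1 : ss.reverse = sizesNB P φ.clauses := by rw [hss, List.reverse_reverse]
  have hlen : P.fv.length = numNB P φ.clauses := by
    rw [hfv, List.length_reverse, hdom.length_eq, ← List.length_reverse, e1]; simp [sizesNB]
  have hdom' : List.Forall₂ (· ≤ ·) P.fv (sizesNB P φ.clauses) := by
    rw [hfv, ← e1]; exact List.forall₂_reverse_iff.2 hdom
  have hsum : fSum P φ.clauses = ds.sum := by
    rw [fSum_eq_sum_of_numNB P φ.clauses hlen hdom', hfv, List.sum_reverse]
  unfold vecW KCNF.encode
  rw [numVars_reduce, hsum]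
  simp [wFam, reduce]

end Literature.Computability.FineGrained.IPRenameM
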